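import Mathlib
import Literature.Probability.LatticeModels.CornerFugacityMeasure

/-!
# Sketch — first lemmas of three crux-ideate cards for `IKMixedBoxCrossing` (stmt-CriticalPhenomena-5911)

Elaboration check only (`sorry` bodies). The mixed IK/𝕋 colour field of the crux is, on every finite
box, `cornerGibbsMeasure t V Λ ξ` with `t = √3/2` and `V` = the faces lying in `S`-columns
(faces in 𝕋-columns carry fugacity `1`, i.e. are simply omitted from `V`), so statements quantified
over an ARBITRARY interaction-vertex set `V` cover every column pattern `S` at once.
-/

namespace Summit.CriticalPhenomena.CardyFormulaZ2.Cruxes.IKMixedBoxCrossing.Sketch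

open MeasureTheory ProbabilityTheory Finset
open scoped ENNReal NNReal
open Literature.Probability.LatticeModels

/-- Card `xor-rectangle-flip`, first lemma (XOR quasi-invariance): flipping all colours inside an
axis-parallel rectangle of cells contained in the volume changes the Gibbs weight by at most `t^{∓4}`
(only the four corner vertices of the rectangle can change parity), for EVERY interaction set `V`
(every column pattern `S`), every boundary condition `ξ` and every event `A`. -/
theorem xor_rectangle_quasi_invariance (t : ℝ≥0) (ht : t ≠ 0) (V Λ : Finset (Site 2))
    (ξ : Site 2 → Bool) (x₁ x₂ y₁ y₂ : ℤ)
    (hQ : ∀ c : Site 2, x₁ ≤ c 0 → c 0 ≤ x₂ → y₁ ≤ c 1 → c 1 ≤ y₂ → c ∈ Λ)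
    (A : Set (Site 2 → Bool)) :
    cornerGibbsMeasure t V Λ ξ
        {σ | (fun c : Site 2 => if x₁ ≤ c 0 ∧ c 0 ≤ x₂ ∧ y₁ ≤ c 1 ∧ c 1 ≤ y₂ then !σ c else σ c) ∈ A}
      ≤ ((t : ℝ≥0∞)⁻¹) ^ 4 * cornerGibbsMeasure t V Λ ξ A := by
  sorry

/-- Card `xor-rectangle-flip`, combinatorial core behind the lemma above: a rectangle flip changes the
odd-face count on any vertex set by at most four. -/
theorem oddFaceCount_xor_rectangle_le (V : Finset (Site 2)) (σ : Site 2 → Bool) (x₁ x₂ y₁ y₂ : ℤ) :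
    (oddFaceCount V
        (fun c : Site 2 => if x₁ ≤ c 0 ∧ c 0 ≤ x₂ ∧ y₁ ≤ c 1 ∧ c 1 ≤ y₂ then !σ c else σ c) : ℤ)
      ≤ (oddFaceCount V σ : ℤ) + 4 := by
  sorry

/-- Card `paired-mirror-exploration`, first lemma (paired symmetrisation replaces both the
independence step and the Harris step of Smirnov's RSW doubling): for a measure-preserving map `Φ`
and a `Φ`-equivariant finite family of disjoint-able "exploration" events `E i` (with `Φ ⁻¹' E (i⋆) = E i`),
if on each `E i` one of the black event `B i` or the `Φ`-mirror of `B (i⋆)` always occurs (planar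
duality), then `∑ P(E i) ≤ 2 ∑ P(E i ∩ B i)` — no positive association, no domain Markov property. -/
theorem paired_symmetrisation {Ω : Type*} [MeasurableSpace Ω] (P : Measure Ω) [IsProbabilityMeasure P]
    (Φ : Ω → Ω) (hΦ : MeasurePreserving Φ P P) {ι : Type*} (s : Finset ι) (star : ι → ι)
    (hstar : ∀ i ∈ s, star i ∈ s) (hinv : ∀ i, star (star i) = i)
    (E B : ι → Set Ω) (hE : ∀ i, MeasurableSet (E i)) (hB : ∀ i, MeasurableSet (B i))
    (hΦE : ∀ i, Φ ⁻¹' (E (star i)) = E i)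
    (hdual : ∀ i ∈ s, E i ⊆ B i ∪ Φ ⁻¹' (B (star i))) :
    ∑ i ∈ s, P.real (E i) ≤ 2 * ∑ i ∈ s, P.real (E i ∩ B i) := by
  sorry

/-- Card `defect-closure-exploration`, first lemma (locality of the parity projection): for every
finite set `C` of grid vertices and every target parity pattern `g` on `C` there is a colouring `η`
supported on the cells of the faces of `C` whose odd faces inside `C` are exactly `g` — the face-parity
functionals are linearly independent over `𝔽₂` even when restricted to their own cells, so the
`2^{|C|}`-to-`1` "enslaving" correction of a defect polymer `C` can be chosen inside `C`'s own cells. -/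
theorem exists_colouring_with_prescribed_odd_faces (C : Finset (Site 2)) (g : Site 2 → Bool) :
    ∃ η : Site 2 → Bool, (∀ c : Site 2, η c = true → ∃ v ∈ C, c ∈ cellFace v) ∧
      ∀ v ∈ C, (IsOddFace η v ↔ g v = true) := by
  sorry

/-- Card `defect-closure-exploration`, the law identity in its simplest finite form (one masked face):
at fugacity `t ≤ 1`, the free plaquette field on `Λ` is the mixture, over an independent
`Bernoulli(1 - t)`… more precisely with mask probability `ρ = (1 - t)/(1 + t)` per vertex of `V`, of the
uniform colourings conditioned to be even on the masked vertices.  Stated for a single vertex `v` of a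
FREE interaction set (`V ⊆ innerVertices Λ`, where the parity at `v` is a fair coordinate independent of
the other weights): `μ_{t,V} = (1 - ρ) · μ_{t, V \ {v}} + ρ · μ_{t, V \ {v}}( · | v even)`. -/
theorem cornerGibbsMeasure_mask_one_vertex (t : ℝ≥0) (ht0 : t ≠ 0) (ht1 : t ≤ 1)
    (V Λ : Finset (Site 2)) (hV : V ⊆ innerVertices Λ) (v : Site 2) (hv : v ∈ V) (ξ : Site 2 → Bool)
    (A : Set (Site 2 → Bool)) (hA : MeasurableSet A) :
    cornerGibbsMeasure t V Λ ξ A =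
      (1 - ENNReal.ofReal ((1 - (t : ℝ)) / (1 + t))) * cornerGibbsMeasure t (V.erase v) Λ ξ A +
      ENNReal.ofReal ((1 - (t : ℝ)) / (1 + t)) *
        (cornerGibbsMeasure t (V.erase v) Λ ξ (A ∩ {σ | ¬ IsOddFace σ v}) /
          cornerGibbsMeasure t (V.erase v) Λ ξ {σ | ¬ IsOddFace σ v}) := by
  sorry

end Summit.CriticalPhenomena.CardyFormulaZ2.Cruxes.IKMixedBoxCrossing.Sketch
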